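import Mathlib
import Summits.NavierStokesRegularity.NavierStokesRegularity.Theorems.LerayQuarterDissipationFiniteDissipationLiouvilleVorticityAmplitudeThreshold
import HarnessLib

/-!
# Crux `FiniteDissipationLiouville` (stmt-NavierStokesRegularity-22144): the vorticity amplitude
# of a singular member exceeds `√3/4 + ε(C,K)` in EVERY long backward log-window, hence near the
# apex and in the far past

Theorems file of route `LerayQuarterDissipation` (lead prover g15; `--supports` the crux; portrait
fact for the registered stub `stub_envelopeCriticalLiouville` of skeleton `Lines/birth.lean`; the
window form of `…VorticityAmplitude` / `…VorticityAmplitudeThreshold`, on the pattern of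
`…Amplitude.amplitude_exceeds_of_singular`). Navier–Stokes regularity is NOT proved by anything
here; no summit is.

`𝒟_{C,K}`: Type-I ancient mild fields `u` (KNSS gauge, `IsTypeIAncientMild C u`) with the
quarter-rate law `∫‖Du(t)‖² ≤ K/√(−t)`. `…VorticityAmplitudeThreshold.exists_vorticity_gap`: there is
`ε(C,K) > 0` such that no singular member has `(−t)‖curl u(t,x)‖ ≤ √3/4 + ε` for ALL `t < 0`, `x`.
This file upgrades "for all `t`" to "on log-time windows of unbounded length":

* `notSingular_of_vorticity_le_windows` — with the same `ε(C,K)`: if for every `Λ > 1` some backward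
  window `[Λ²τ, τ/Λ²]` (`τ < 0`) has `(−t)‖curl u(t,x)‖ ≤ √3/4 + ε` for all its `t` and ALL `x`, then
  `u` is bounded at the apex (the orbit limit along the window scales — `Compactness.seqLimit` on the
  rescalings `u_{√(−τ_k)}`, law by `law_of_seqLimit`, vorticity bound by the pointwise convergence of
  the gradients and `curl = curlCLM ∘ D` — is a member of `𝒟_{C,K}` obeying the bound for ALL `t`,
  and is singular by persistence: excluded);
* `vorticity_exceeds_windows_of_singular` — contrapositive, the quotable form: **for a SINGULAR
  member there is a window length `Λ` such that every backward window `[Λ²τ, τ/Λ²]` contains a point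
  with `√3/4 + ε(C,K) < (−t)‖curl u(t,x)‖`**;
* `vorticity_exceeds_farPast_of_singular`, `vorticity_exceeds_nearApex_of_singular` — hence
  `limsup_{t→−∞} sup_x (−t)‖ω‖ > √3/4` and `limsup_{t→0⁻} sup_x (−t)‖ω‖ > √3/4` (`≥ √3/4 + ε(C,K)`)
  on every singular member of the stratum: the vorticity analogue of
  `…Amplitude.amplitude_exceeds_farPast/nearApex_of_singular` (velocity, threshold `1`).

HONEST FRAMING. `ε(C,K)` is ineffective (compactness); a portrait clause of the hypothetical singular
profile; nothing is removed from the catalogued DSS wall (`TypeIDSSLiouville`, NECESSARY for the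
crux); nothing here bears on Navier–Stokes regularity or blow-up.

References: Koch–Nadirashvili–Seregin–Šverák, Acta Math. 203 (2009) §4 (compactness of the class);
folklore.
-/

noncomputable section

set_option linter.dupNamespace false

namespace Summit.NavierStokesRegularity.NavierStokesRegularity.Theorems.FiniteDissipationLiouville.VorticityAmplitude

open MeasureTheory Set Filter Topology Metric Function Real
open scoped ENNReal
open Literature.Analysis Literature.Analysis.FluidPDE
open Summit.NavierStokesRegularity.NavierStokesRegularity.Theorems
open Summit.NavierStokesRegularity.NavierStokesRegularity.Theorems.FiniteDissipationLiouville

/-- **Vorticity amplitude below the collar on long windows forces apex regularity.** For all `C, K`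
there is `ε > 0` (that of `exists_vorticity_gap`) such that: if `u ∈ 𝒟_{C,K}` and for every `Λ > 1`
there is `τ < 0` with `(−t)‖curl u(t,x)‖ ≤ √3/4 + ε` for all `t ∈ [Λ²τ, τ/Λ²]` and all `x`, then `u`
is bounded on some backward cylinder at the origin. [cite: KochNadirashviliSereginSverak2009, §4 (arXiv:0709.3599 p. 8)] -/
theorem notSingular_of_vorticity_le_windows (C K : ℝ) : ∃ ε : ℝ, 0 < ε ∧
    ∀ (u : ℝ → EuclideanSpace ℝ (Fin 3) → EuclideanSpace ℝ (Fin 3)), IsTypeIAncientMild C u →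
      (∀ s : ℝ, s < 0 → ∫⁻ x, ‖fderiv ℝ (u s) x‖ₑ ^ 2 ≤ ENNReal.ofReal (K / Real.sqrt (-s))) →
      (∀ Λ : ℝ, 1 < Λ → ∃ τ : ℝ, τ < 0 ∧ ∀ t ∈ Set.Icc (Λ ^ 2 * τ) (τ / Λ ^ 2), ∀ x,
        (-t) * ‖curl (u t) x‖ ≤ Real.sqrt 3 / 4 + ε) →
      ¬ (∀ r > 0, ∀ M : ℝ, ∃ t ∈ Set.Ioo (-(r ^ 2)) (0 : ℝ),
          ∃ x ∈ Metric.ball (0 : EuclideanSpace ℝ (Fin 3)) r, M < ‖u t x‖) := by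
  obtain ⟨ε, hε, hgap⟩ := exists_vorticity_gap C K
  refine ⟨ε, hε, fun u hu hlaw hwin hsing => ?_⟩
  set θ : ℝ := Real.sqrt 3 / 4 + ε with hθ
  -- windows at `Λ_k = k + 2`, scales `l_k = √(-τ_k)`
  have hΛ : ∀ k : ℕ, (1 : ℝ) < (k : ℝ) + 2 := fun k => by
    have : (0 : ℝ) ≤ k := Nat.cast_nonneg k
    linarith
  choose τ hτ hτwin using fun k : ℕ => hwin ((k : ℝ) + 2) (hΛ k)
  set l : ℕ → ℝ := fun k => Real.sqrt (-τ k) with hl_def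
  have hl : ∀ k, 0 < l k := fun k => Real.sqrt_pos.2 (neg_pos.2 (hτ k))
  have hl2 : ∀ k, l k ^ 2 = -τ k := fun k => Real.sq_sqrt (neg_pos.2 (hτ k)).le
  -- the rescaled members
  set v : ℕ → ℝ → EuclideanSpace ℝ (Fin 3) → EuclideanSpace ℝ (Fin 3) := fun k => nsRescale (l k) u
    with hvdef
  have hv : ∀ k, IsTypeIAncientMild C (v k) := fun k => hu.nsRescale (hl k)
  have hvlaw : ∀ k, ∀ s : ℝ, s < 0 →
      ∫⁻ x, ‖fderiv ℝ (v k s) x‖ₑ ^ 2 ≤ ENNReal.ofReal (K / Real.sqrt (-s)) := fun k =>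
    RecurrentReductionD.dissipationLaw_nsRescale hlaw (hl k)
  have hvsing : ∀ k, ∀ r > 0, ∀ M : ℝ, ∃ t ∈ Ioo (-(r ^ 2)) (0 : ℝ),
      ∃ x ∈ ball (0 : EuclideanSpace ℝ (Fin 3)) r, M < ‖v k t x‖ := fun k =>
    RecurrentReductionD.singularAtOrigin_nsRescale hsing (hl k)
  -- the rescaled vorticity bound, eventually for every fixed `s < 0`
  have hev : ∀ s : ℝ, s < 0 → ∀ᶠ k : ℕ in atTop, ∀ y, (-s) * ‖curl (v k s) y‖ ≤ θ := by
    intro s hs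
    have hT : Tendsto (fun k : ℕ => ((k : ℝ) + 2) ^ 2) atTop atTop :=
      (tendsto_pow_atTop two_ne_zero).comp
        (tendsto_atTop_add_const_right atTop (2 : ℝ) tendsto_natCast_atTop_atTop)
    filter_upwards [hT.eventually_ge_atTop (-s), hT.eventually_ge_atTop (-s⁻¹)] with k h1 h2 y
    have hτ' : 0 < -τ k := neg_pos.2 (hτ k)
    have hs' : 0 < -s := neg_pos.2 hs
    -- the rescaled time `l_k² s` lies in the `k`-th window
    have hmem : l k ^ 2 * s ∈ Set.Icc (((k : ℝ) + 2) ^ 2 * τ k) (τ k / ((k : ℝ) + 2) ^ 2) := by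
      rw [hl2 k]
      refine ⟨by nlinarith, ?_⟩
      have hΛ2 : (0 : ℝ) < ((k : ℝ) + 2) ^ 2 := by positivity
      rw [le_div_iff₀ hΛ2]
      have h3 : 1 ≤ (-s) * ((k : ℝ) + 2) ^ 2 := by
        have := mul_le_mul_of_nonneg_left h2 hs'.le
        rwa [show (-s) * (-s⁻¹) = 1 by rw [neg_mul_neg, mul_inv_cancel₀ hs.ne]] at this
      nlinarith
    have key := hτwin k (l k ^ 2 * s) hmem (l k • y)
    -- `(-s) ‖curl u_l(s)(y)‖ = (-(l² s)) ‖curl u(l² s)(l y)‖`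
    rw [hvdef]
    dsimp only
    rw [QuietVorticity.curl_nsRescale, norm_smul, Real.norm_of_nonneg (mul_self_nonneg _)]
    calc (-s) * (l k * l k * ‖curl (u (l k ^ 2 * s)) (l k • y)‖)
        = (-(l k ^ 2 * s)) * ‖curl (u (l k ^ 2 * s)) (l k • y)‖ := by ring
      _ ≤ θ := key
  -- KNSS limit along the scales: a member of `𝒟_{C,K}`, singular, with the bound for ALL `t`
  obtain ⟨ψ, hψ, W, hW, hunif, hpt, hgrad⟩ := Compactness.seqLimit hv
  have hψt : Tendsto ψ atTop atTop := hψ.tendsto_atTop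
  have hWlaw : ∀ s : ℝ, s < 0 →
      ∫⁻ x, ‖fderiv ℝ (W s) x‖ₑ ^ 2 ≤ ENNReal.ofReal (K / Real.sqrt (-s)) :=
    Compactness.law_of_seqLimit (Kk := fun _ => K) (Kinf := K) hψt hvlaw
      (fun ε hε => Eventually.of_forall fun k => by linarith) hgrad
  have hWsing := Compactness.persistent_singularity_seq (w := fun j => v (ψ j))
    (fun j => hv _) (fun j => hvlaw _) (fun j => hvsing _) hW hunif
  have hWθ : ∀ s : ℝ, s < 0 → ∀ y, (-s) * ‖curl (W s) y‖ ≤ θ := by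
    intro s hs y
    have h1 : Tendsto (fun j => (-s) * ‖curl (v (ψ j) s) y‖) atTop (𝓝 ((-s) * ‖curl (W s) y‖)) := by
      have hc : Tendsto (fun j => curl (v (ψ j) s) y) atTop (𝓝 (curl (W s) y)) := by
        simp only [curl_eq_curlCLM]
        exact (curlCLM.continuous.tendsto _).comp (hgrad s hs y)
      exact tendsto_const_nhds.mul hc.norm
    exact le_of_tendsto h1 ((hψt.eventually (hev s hs)).mono fun j hj => hj y)
  exact hgap W hW hWlaw hWθ hWsing

/-- **A singular finite-dissipation profile has vorticity amplitude above `√3/4 + ε(C,K)` in every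
long log-window**: for all `C, K` there is `ε > 0` such that every SINGULAR member `u` of `𝒟_{C,K}`
admits `Λ > 1` with: every backward window `[Λ²τ, τ/Λ²]` (`τ < 0`) contains `(t, x)` with
`√3/4 + ε < (−t)‖curl u(t,x)‖`. [cite: KochNadirashviliSereginSverak2009, §4 (arXiv:0709.3599 p. 8)] -/
theorem vorticity_exceeds_windows_of_singular (C K : ℝ) : ∃ ε : ℝ, 0 < ε ∧
    ∀ (u : ℝ → EuclideanSpace ℝ (Fin 3) → EuclideanSpace ℝ (Fin 3)), IsTypeIAncientMild C u →
      (∀ s : ℝ, s < 0 → ∫⁻ x, ‖fderiv ℝ (u s) x‖ₑ ^ 2 ≤ ENNReal.ofReal (K / Real.sqrt (-s))) →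
      (∀ r > 0, ∀ M : ℝ, ∃ t ∈ Set.Ioo (-(r ^ 2)) (0 : ℝ),
          ∃ x ∈ Metric.ball (0 : EuclideanSpace ℝ (Fin 3)) r, M < ‖u t x‖) →
      ∃ Λ : ℝ, 1 < Λ ∧ ∀ τ : ℝ, τ < 0 →
        ∃ t ∈ Set.Icc (Λ ^ 2 * τ) (τ / Λ ^ 2), ∃ x, Real.sqrt 3 / 4 + ε < (-t) * ‖curl (u t) x‖ := by
  obtain ⟨ε, hε, h⟩ := notSingular_of_vorticity_le_windows C K
  refine ⟨ε, hε, fun u hu hlaw hsing => ?_⟩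
  by_contra hcon
  push Not at hcon
  exact h u hu hlaw hcon hsing

/-- **Far past**: for all `C, K` there is `ε > 0` such that every singular member of `𝒟_{C,K}` has,
for every `T < 0`, a point `(t, x)` with `t ≤ T` and `√3/4 + ε < (−t)‖curl u(t,x)‖`
(`limsup_{t→−∞} sup_x (−t)‖ω‖ ≥ √3/4 + ε`). -/
theorem vorticity_exceeds_farPast_of_singular (C K : ℝ) : ∃ ε : ℝ, 0 < ε ∧
    ∀ (u : ℝ → EuclideanSpace ℝ (Fin 3) → EuclideanSpace ℝ (Fin 3)), IsTypeIAncientMild C u →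
      (∀ s : ℝ, s < 0 → ∫⁻ x, ‖fderiv ℝ (u s) x‖ₑ ^ 2 ≤ ENNReal.ofReal (K / Real.sqrt (-s))) →
      (∀ r > 0, ∀ M : ℝ, ∃ t ∈ Set.Ioo (-(r ^ 2)) (0 : ℝ),
          ∃ x ∈ Metric.ball (0 : EuclideanSpace ℝ (Fin 3)) r, M < ‖u t x‖) →
      ∀ T : ℝ, T < 0 → ∃ t : ℝ, t ≤ T ∧ ∃ x, Real.sqrt 3 / 4 + ε < (-t) * ‖curl (u t) x‖ := by
  obtain ⟨ε, hε, h⟩ := vorticity_exceeds_windows_of_singular C K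
  refine ⟨ε, hε, fun u hu hlaw hsing T hT => ?_⟩
  obtain ⟨Λ, hΛ, hwin⟩ := h u hu hlaw hsing
  have hΛ2 : (0 : ℝ) < Λ ^ 2 := by positivity
  obtain ⟨t, ht, x, hx⟩ := hwin (Λ ^ 2 * T) (mul_neg_of_pos_of_neg hΛ2 hT)
  refine ⟨t, ?_, x, hx⟩
  have h1 : t ≤ Λ ^ 2 * T / Λ ^ 2 := ht.2
  rwa [mul_div_cancel_left₀ _ (by positivity : Λ ^ 2 ≠ 0)] at h1

/-- **Near the apex**: for all `C, K` there is `ε > 0` such that every singular member of `𝒟_{C,K}`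
has, for every `T < 0`, a point `(t, x)` with `T ≤ t < 0` and `√3/4 + ε < (−t)‖curl u(t,x)‖`
(`limsup_{t→0⁻} sup_x (−t)‖ω‖ ≥ √3/4 + ε`): the blow-up rate of the vorticity of a finite-dissipation
Type-I singularity carries at least the constant `√3/4` in the scale-invariant normalisation. -/
theorem vorticity_exceeds_nearApex_of_singular (C K : ℝ) : ∃ ε : ℝ, 0 < ε ∧
    ∀ (u : ℝ → EuclideanSpace ℝ (Fin 3) → EuclideanSpace ℝ (Fin 3)), IsTypeIAncientMild C u →
      (∀ s : ℝ, s < 0 → ∫⁻ x, ‖fderiv ℝ (u s) x‖ₑ ^ 2 ≤ ENNReal.ofReal (K / Real.sqrt (-s))) →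
      (∀ r > 0, ∀ M : ℝ, ∃ t ∈ Set.Ioo (-(r ^ 2)) (0 : ℝ),
          ∃ x ∈ Metric.ball (0 : EuclideanSpace ℝ (Fin 3)) r, M < ‖u t x‖) →
      ∀ T : ℝ, T < 0 → ∃ t : ℝ, T ≤ t ∧ t < 0 ∧ ∃ x, Real.sqrt 3 / 4 + ε < (-t) * ‖curl (u t) x‖ := by
  obtain ⟨ε, hε, h⟩ := vorticity_exceeds_windows_of_singular C K
  refine ⟨ε, hε, fun u hu hlaw hsing T hT => ?_⟩
  obtain ⟨Λ, hΛ, hwin⟩ := h u hu hlaw hsing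
  have hΛ2 : (0 : ℝ) < Λ ^ 2 := by positivity
  obtain ⟨t, ht, x, hx⟩ := hwin (T / Λ ^ 2) (div_neg_of_neg_of_pos hT hΛ2)
  refine ⟨t, ?_, ?_, x, hx⟩
  · have h1 : Λ ^ 2 * (T / Λ ^ 2) ≤ t := ht.1
    rwa [mul_div_cancel₀ _ hΛ2.ne'] at h1
  · have h2 : t ≤ T / Λ ^ 2 / Λ ^ 2 := ht.2
    have h3 : T / Λ ^ 2 / Λ ^ 2 < 0 := div_neg_of_neg_of_pos (div_neg_of_neg_of_pos hT hΛ2) hΛ2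
    linarith

end Summit.NavierStokesRegularity.NavierStokesRegularity.Theorems.FiniteDissipationLiouville.VorticityAmplitude

end
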